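import Literature.NumberTheory.LFunctions.WeilExplicitArchTermProofs

/-!
# `Re W(g) > 0` for non-negative bumps supported right of `1/2`, off the primes

Negative-side support for crux `SpectralTrace.WindowTracePrime2` (stmt-RiemannHypothesis-11196;
cdisprove seat refuter-cdisprove-stmt-RiemannHypothesis-11196-0), second engine of the lattice no-go
`Negative/Progressions.lean`. For `g` the complexification of a smooth non-negative bump `b`
supported in `[m - r, m + r] ⊆ [1/2, ∞)` containing no `log n` (`n ≥ 2`):
`weilPrimeTerm g = 0`, `weilPolarTerm g = ∫ b (e^{-t/2} + e^{t/2})`,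
`weilArchTerm g = -∫₀^∞ e^{t/2} b/(2 sinh t)` (Bombieri's form,
`weilArchTermBombieri_eq_weilArchTerm_holds`), hence
`Re W(g) ≥ ∫ b e^{-t/2} ≥ e^{-(m+r)/2} ∫ b > 0` since `2 sinh t ≥ 1` on the support
(`weilFunctional_bumpC_re_pos`). The test `g` is kept as a variable with the pointwise hypothesis
`∀ t, g t = b t`.
-/

noncomputable section

open Complex Filter Set MeasureTheory
open scoped Real Topology

namespace Summit.RiemannHypothesis.RiemannHypothesis.Theorems.WindowTracePrime2.Negative

open Literature.NumberTheory.LFunctions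

section BumpPositivity

variable {m : ℝ} (b : ContDiffBump m) {g : ℝ → ℂ} (hgb : ∀ t, g t = ((b t : ℝ) : ℂ))
include hgb

/-- `g` is the complexified bump. [folklore] -/
theorem bumpC_eq : g = fun t => ((b t : ℝ) : ℂ) := funext hgb

/-- The complexified bump is a Weil test. [folklore] -/
theorem isWeilTest_bumpC : IsWeilTest g := by
  rw [bumpC_eq b hgb]
  exact ⟨Complex.ofRealCLM.contDiff.comp b.contDiff, b.hasCompactSupport.comp_left Complex.ofReal_zero⟩

/-- Its support is `[m - r, m + r]`. [folklore] -/
theorem tsupport_bumpC : tsupport g ⊆ Set.Icc (m - b.rOut) (m + b.rOut) := by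
  rw [bumpC_eq b hgb]
  refine (tsupport_comp_subset Complex.ofReal_zero _).trans ?_
  rw [b.tsupport_eq, Real.closedBall_eq_Icc]

/-- It vanishes off `[m - r, m + r]`. [folklore] -/
theorem bumpC_eq_zero {t : ℝ} (ht : t ∉ Set.Icc (m - b.rOut) (m + b.rOut)) : g t = 0 :=
  image_eq_zero_of_notMem_tsupport fun h => ht (tsupport_bumpC b hgb h)

/-- The real bump vanishes off `[m - r, m + r]`. [folklore] -/
theorem bump_eq_zero {t : ℝ} (ht : t ∉ Set.Icc (m - b.rOut) (m + b.rOut)) : b t = 0 := by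
  have := bumpC_eq_zero b hgb ht
  rw [hgb] at this
  exact_mod_cast this

/-- The polar term as a real integral: `ĝ(0) + ĝ(1) = ∫ b(t)(e^{-t/2} + e^{t/2}) dt`. -/
theorem weilPolarTerm_bumpC :
    weilPolarTerm g = ((∫ t : ℝ, b t * (Real.exp (-t / 2) + Real.exp (t / 2)) : ℝ) : ℂ) := by
  rw [← integral_complex_ofReal]
  unfold weilPolarTerm weilMellin
  rw [← integral_add]
  · congr 1 with t
    rw [hgb]
    push_cast
    have e1 : cexp ((0 - 1 / 2) * (t : ℂ)) = cexp (-(t : ℂ) / 2) := by congr 1; ring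
    have e2 : cexp ((1 - 1 / 2) * (t : ℂ)) = cexp ((t : ℂ) / 2) := by congr 1; ring
    rw [e1, e2]
    ring
  · exact ((isWeilTest_bumpC b hgb).1.continuous.mul (by fun_prop)).integrable_of_hasCompactSupport
      (isWeilTest_bumpC b hgb).2.mul_right
  · exact ((isWeilTest_bumpC b hgb).1.continuous.mul (by fun_prop)).integrable_of_hasCompactSupport
      (isWeilTest_bumpC b hgb).2.mul_right

variable (hc : 1 / 2 ≤ m - b.rOut)
include hc

/-- With `1/2 ≤ m - r` the complexified bump vanishes on `(-∞, 0]`. [folklore] -/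
theorem bumpC_eq_zero_of_nonpos {t : ℝ} (ht : t ≤ 0) : g t = 0 :=
  bumpC_eq_zero b hgb fun h => by have := h.1; linarith

/-- With `1/2 ≤ m - r` the bump vanishes on `(-∞, 0]`. [folklore] -/
theorem bump_eq_zero_of_nonpos {t : ℝ} (ht : t ≤ 0) : b t = 0 :=
  bump_eq_zero b hgb fun h => by have := h.1; linarith

/-- No prime enters: `log n ∉ supp` by hypothesis and `-log n ≤ 0 < 1/2 ≤ inf supp`. -/
theorem weilPrimeTerm_bumpC
    (hlog : ∀ n : ℕ, 2 ≤ n → Real.log n ∉ Set.Icc (m - b.rOut) (m + b.rOut)) :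
    weilPrimeTerm g = 0 := by
  unfold weilPrimeTerm
  refine (tsum_congr fun n => ?_).trans tsum_zero
  rcases Nat.lt_or_ge n 2 with hn | hn
  · interval_cases n <;> simp
  · have h1 : g (Real.log n) = 0 := bumpC_eq_zero b hgb (hlog n hn)
    have hn' : (1 : ℝ) ≤ n := by exact_mod_cast (by omega : 1 ≤ n)
    have h2 : g (-Real.log n) = 0 :=
      bumpC_eq_zero_of_nonpos b hgb hc (by linarith [Real.log_nonneg hn'])
    rw [h1, h2]
    simp

/-- The archimedean term (Bombieri's form, `g(0) = 0`, `g(-t) = 0` for `t > 0`):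
`W_∞(g) = -∫₀^∞ e^{t/2} b(t)/(2 sinh t) dt`. -/
theorem weilArchTerm_bumpC :
    weilArchTerm g =
      -(((∫ t in Set.Ioi (0 : ℝ), Real.exp (t / 2) * b t / (2 * Real.sinh t) : ℝ) : ℂ)) := by
  rw [← weilArchTermBombieri_eq_weilArchTerm_holds (isWeilTest_bumpC b hgb), weilArchTermBombieri,
    bumpC_eq_zero_of_nonpos b hgb hc le_rfl, ← integral_complex_ofReal]
  simp only [mul_zero, zero_add, sub_zero]
  congr 1
  refine setIntegral_congr_fun measurableSet_Ioi fun t ht => ?_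
  have ht' : -t ≤ 0 := by have : (0 : ℝ) < t := ht; linarith
  rw [bumpC_eq_zero_of_nonpos b hgb hc ht', hgb]
  simp only [add_zero]
  push_cast
  ring

/-- **`Re W(g) > 0`** for the complexified non-negative bump `g = b` supported in
`[m - r, m + r] ⊆ [1/2, ∞)` containing no `log n` (`n ≥ 2`): `W(g) = ∫ b·(e^{-t/2} + e^{t/2}) −
∫₀^∞ e^{t/2} b/(2 sinh t) ≥ ∫ b e^{-t/2} > 0` since `2 sinh t ≥ 1` on the support. -/
theorem weilFunctional_bumpC_re_pos
    (hlog : ∀ n : ℕ, 2 ≤ n → Real.log n ∉ Set.Icc (m - b.rOut) (m + b.rOut)) :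
    0 < (weilFunctional g).re := by
  rw [weilFunctional, weilPrimeTerm_bumpC b hgb hc hlog, sub_zero, weilPolarTerm_bumpC b hgb,
    weilArchTerm_bumpC b hgb hc]
  simp only [Complex.add_re, Complex.neg_re, Complex.ofReal_re]
  -- integrability facts
  have hbi : Integrable (fun t : ℝ => b t) := b.continuous.integrable_of_hasCompactSupport b.hasCompactSupport
  have hi1 : Integrable fun t : ℝ => b t * (Real.exp (-t / 2) + Real.exp (t / 2)) :=
    (b.continuous.mul (by fun_prop)).integrable_of_hasCompactSupport b.hasCompactSupport.mul_right
  have hi2 : Integrable fun t : ℝ => Real.exp (t / 2) * b t :=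
    ((by fun_prop : Continuous fun t : ℝ => Real.exp (t / 2)).mul b.continuous).integrable_of_hasCompactSupport
      b.hasCompactSupport.mul_left
  -- the archimedean integral is at most `∫ e^{t/2} b` (since `2 sinh t ≥ 1` where `b ≠ 0`)
  have hA : ∫ t in Set.Ioi (0 : ℝ), Real.exp (t / 2) * b t / (2 * Real.sinh t) ≤
      ∫ t in Set.Ioi (0 : ℝ), Real.exp (t / 2) * b t := by
    refine integral_mono_of_nonneg ?_ hi2.integrableOn ?_
    · filter_upwards [ae_restrict_mem measurableSet_Ioi] with t ht
      exact div_nonneg (mul_nonneg (Real.exp_pos _).le b.nonneg)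
        (mul_nonneg zero_le_two (Real.sinh_nonneg_iff.2 (le_of_lt ht)))
    · filter_upwards [ae_restrict_mem measurableSet_Ioi] with t ht
      by_cases hts : t ∈ Set.Icc (m - b.rOut) (m + b.rOut)
      · have ht2 : 1 ≤ 2 * Real.sinh t := by
          have h1 : (1 / 2 : ℝ) ≤ t := by have := hts.1; linarith
          have h2 : t ≤ Real.sinh t := Real.self_le_sinh_iff.2 (by linarith)
          linarith
        rw [div_le_iff₀ (by linarith)]
        nlinarith [mul_nonneg (Real.exp_pos (t / 2)).le (b.nonneg (x := t))]
      · rw [bump_eq_zero b hgb hts]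
        simp
  -- `∫₀^∞ e^{t/2} b = ∫ e^{t/2} b` (the integrand vanishes for `t ≤ 0`)
  have hA' : ∫ t in Set.Ioi (0 : ℝ), Real.exp (t / 2) * b t = ∫ t, Real.exp (t / 2) * b t := by
    refine setIntegral_eq_integral_of_forall_compl_eq_zero fun t ht => ?_
    rw [bump_eq_zero_of_nonpos b hgb hc (by simpa using ht), mul_zero]
  -- lower bound `∫ b e^{-t/2} ≥ e^{-(m + r)/2} ∫ b > 0`
  have hlow : Real.exp (-(m + b.rOut) / 2) * ∫ t, b t ≤ ∫ t, b t * Real.exp (-t / 2) := by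
    rw [← integral_const_mul]
    refine integral_mono (hbi.const_mul _) ?_ fun t => ?_
    · exact (b.continuous.mul (by fun_prop)).integrable_of_hasCompactSupport b.hasCompactSupport.mul_right
    · show Real.exp (-(m + b.rOut) / 2) * b t ≤ b t * Real.exp (-t / 2)
      by_cases hts : t ∈ Set.Icc (m - b.rOut) (m + b.rOut)
      · have : Real.exp (-(m + b.rOut) / 2) ≤ Real.exp (-t / 2) :=
          Real.exp_le_exp.2 (by have := hts.2; linarith)
        nlinarith [b.nonneg (x := t)]
      · rw [bump_eq_zero b hgb hts]
        simp
  have hsplit : ∫ t, b t * (Real.exp (-t / 2) + Real.exp (t / 2)) =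
      (∫ t, b t * Real.exp (-t / 2)) + ∫ t, Real.exp (t / 2) * b t := by
    rw [← integral_add]
    · congr 1 with t
      ring
    · exact (b.continuous.mul (by fun_prop)).integrable_of_hasCompactSupport b.hasCompactSupport.mul_right
    · exact hi2
  have hpos : 0 < Real.exp (-(m + b.rOut) / 2) * ∫ t, b t := mul_pos (Real.exp_pos _) b.integral_pos
  rw [hsplit]
  linarith

end BumpPositivity

end Summit.RiemannHypothesis.RiemannHypothesis.Theorems.WindowTracePrime2.Negative

end
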